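import Summits.CriticalPhenomena.CardyFormulaZ2.Theorems.CardyFlipRussoQuadrupoleSelectionRuleBitsReduction
import HarnessLib

/-!
# The arm budget at exponent `1` from its two halves: `BulkArm ε → LayerArm → ArmBudget 1`

Helper file for the informal kernel crux `QuadrupoleSelectionRule` (stmt-CriticalPhenomena-7029) of
route `CardyFlipRusso` (sub-problem `CardyFormulaZ2`), line `Sketch`, generation 4 (lead c2,
cycle 2), stub W3 (`armBudget_one_of_bulkArm_layerArm`).  Vocabulary:
`Theorems/CardyFlipRussoQuadrupoleSelectionRuleDefs.lean` (namespace `…Theorems.BitsLeg`: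
`boxN`, `faces`, `card_faces`, `depth`, `cutoff`, `armWeight`, `ArmBudget`, `BulkArm`,
`LayerArm`); the sign facts `armWeight_nonneg`, `cutoff_nonneg` are in `…BitsReduction.lean`.

Mathematics.  Fix a conformal rectangle `R` and a layer constant `C₀ > 0`, and write
`S(t, δ) = Σ_{k ∈ faces R δ} cutoff C₀ 1 δ (depth k) · armWeight R t δ k` for the budget.

* A-priori bounds: `0 ≤ armWeight ≤ 2` (an integral against the probability measure `legLaw t`
  of a sum of two probabilities, `armWeight_le_two`) and `0 ≤ cutoff ≤ 1`
  (`cutoff_le_one`), so `0 ≤ S(t, δ) ≤ 2 · #faces R δ` (`budget_nonneg`, `budget_le_card`).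
* The rate function is `η δ = sSup (S(·, δ) '' [0,1])`; the bound clause of `ArmBudget` is then
  `le_csSup`, and `η → 0` along `𝓝[>] 0` reduces (`tendsto_sSup_image_nhdsGT`) to:
  for every `e > 0`, eventually (as `δ → 0⁺`) `S(t, δ) ≤ e` for all `t ∈ [0,1]`
  (`eventually_budget_le`).
* For the latter split the sum at depth `r₀` (`Finset.sum_filter_add_sum_filter_not`): the faces
  at depth `< r₀` carry total weight `≤ e/2` for small `δ` by `LayerArm` (and `cutoff ≤ 1`);
  at depth `≥ r₀ > C₀ δ` the cut-off factor is `C₀ δ / depth ≤ C₀ δ / r₀`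
  (`cutoff_one_le_div`) and the weight is `≤ C δ^{1+ε}` by `BulkArm ε`, so the bulk part is at
  most `#faces · (C₀ δ / r₀) · C δ^{1+ε} = (#faces · δ²) · (C₀ C / r₀) · δ^ε`, and
  `#faces · δ² = 2 ((2 boxN + 1) δ)² ≤ 2 (2 ρ⁺ + 7)²` for `δ ≤ 1` (`card_faces_mul_sq_le`,
  `boxN = ⌈ρ/δ⌉₊ + 2`), which is `≤ e/2` once `δ^ε` is small (`δ^ε → 0` as `δ → 0⁺`, `ε > 0`).
-/

noncomputable section

open MeasureTheory Filter Topology Set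
open scoped BigOperators

namespace Summit.CriticalPhenomena.CardyFormulaZ2.Theorems.BitsLeg

open Literature.Probability.LatticeModels Literature.Probability.Percolation
  Literature.Probability.RandomPlanarGeometry

/-! ### A-priori bounds on the summands -/

/-- Four-arm weights are at most `2`: the integrand of `armWeight` is a sum of two probabilities
and `legLaw t` is a probability measure. -/
theorem armWeight_le_two (R : ConformalRectangle) (t δ : ℝ) (k : Face) :
    armWeight R t δ k ≤ 2 := by
  unfold armWeight
  refine le_trans (le_abs_self _) ?_
  rw [← Real.norm_eq_abs]
  refine le_trans (norm_integral_le_of_norm_le_const (C := 2) (Eventually.of_forall fun τ => ?_)) ?_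
  · rw [Real.norm_eq_abs, abs_le]
    constructor <;> linarith [measureReal_nonneg (μ := sitePercolation V half)
        (s := crossingEvent R δ (flipGraph (GammaMesh R δ (τ \ {k})) (fA k) (fB k) (fC k) (fD k)) \
          crossingEvent R δ (GammaMesh R δ (τ \ {k}))),
      measureReal_nonneg (μ := sitePercolation V half)
        (s := crossingEvent R δ (GammaMesh R δ (τ \ {k})) \
          crossingEvent R δ (flipGraph (GammaMesh R δ (τ \ {k})) (fA k) (fB k) (fC k) (fD k))),
      measureReal_le_one (μ := sitePercolation V half)
        (s := crossingEvent R δ (flipGraph (GammaMesh R δ (τ \ {k})) (fA k) (fB k) (fC k) (fD k)) \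
          crossingEvent R δ (GammaMesh R δ (τ \ {k}))),
      measureReal_le_one (μ := sitePercolation V half)
        (s := crossingEvent R δ (GammaMesh R δ (τ \ {k})) \
          crossingEvent R δ (flipGraph (GammaMesh R δ (τ \ {k})) (fA k) (fB k) (fC k) (fD k)))]
  · simp

/-- The cut-off factor is at most `1` for a nonnegative exponent (`C₀, δ > 0`): it is `1` in the
layer and `b ^ θ` with base `b = C₀ δ / d ∈ (0, 1)` beyond it. -/
theorem cutoff_le_one {C₀ θ δ : ℝ} (hC₀ : 0 < C₀) (hδ : 0 < δ) (hθ : 0 ≤ θ) (d : ℝ) :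
    cutoff C₀ θ δ d ≤ 1 := by
  unfold cutoff
  split_ifs with h
  · exact le_rfl
  · push Not at h
    have hd : 0 < d := lt_trans (mul_pos hC₀ hδ) h
    exact Real.rpow_le_one (div_pos (mul_pos hC₀ hδ) hd).le ((div_le_one hd).2 h.le) hθ

/-- Beyond depth `r₀ > C₀ δ` the cut-off factor at exponent `1` is at most `C₀ δ / r₀`. -/
theorem cutoff_one_le_div {C₀ δ r₀ d : ℝ} (hC₀ : 0 < C₀) (hδ : 0 < δ) (hr : C₀ * δ < r₀)
    (hd : r₀ ≤ d) : cutoff C₀ 1 δ d ≤ C₀ * δ / r₀ := by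
  unfold cutoff
  rw [if_neg (not_le.2 (lt_of_lt_of_le hr hd)), Real.rpow_one]
  exact div_le_div_of_nonneg_left (mul_pos hC₀ hδ).le (lt_trans (mul_pos hC₀ hδ) hr) hd

/-- The budget sum is nonnegative (`C₀, δ > 0`). -/
theorem budget_nonneg (R : ConformalRectangle) {C₀ θ δ : ℝ} (hC₀ : 0 < C₀) (hδ : 0 < δ) (t : ℝ) :
    0 ≤ ∑ k ∈ faces R δ, cutoff C₀ θ δ (depth R δ k.1) * armWeight R t δ k :=
  Finset.sum_nonneg fun k _ => mul_nonneg (cutoff_nonneg C₀ θ δ _ hC₀ hδ) (armWeight_nonneg R t δ k)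

/-- The budget sum is at most `2 · #faces` (`C₀, δ > 0`, `θ ≥ 0`), uniformly in `t`. -/
theorem budget_le_card (R : ConformalRectangle) {C₀ θ δ : ℝ} (hC₀ : 0 < C₀) (hδ : 0 < δ)
    (hθ : 0 ≤ θ) (t : ℝ) :
    ∑ k ∈ faces R δ, cutoff C₀ θ δ (depth R δ k.1) * armWeight R t δ k ≤ 2 * (faces R δ).card := by
  calc ∑ k ∈ faces R δ, cutoff C₀ θ δ (depth R δ k.1) * armWeight R t δ k
      ≤ ∑ k ∈ faces R δ, (2 : ℝ) := Finset.sum_le_sum fun k _ => by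
        calc cutoff C₀ θ δ (depth R δ k.1) * armWeight R t δ k ≤ 1 * 2 :=
              mul_le_mul (cutoff_le_one hC₀ hδ hθ _) (armWeight_le_two R t δ k)
                (armWeight_nonneg R t δ k) zero_le_one
          _ = 2 := one_mul _
    _ = 2 * (faces R δ).card := by rw [Finset.sum_const, nsmul_eq_mul, mul_comm]

/-! ### Counting the faces -/

/-- `#faces R δ · δ² ≤ 2 (2 ρ⁺ + 7)²` for `δ ∈ (0, 1]`, where `ρ` is the chosen radius bounding
`R` (`boxN R δ = ⌈ρ / δ⌉₊ + 2 ≤ ρ⁺ / δ + 3`). -/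
theorem card_faces_mul_sq_le (R : ConformalRectangle) {δ : ℝ} (hδ : 0 < δ) (hδ1 : δ ≤ 1) :
    ((faces R δ).card : ℝ) * δ ^ 2 ≤
      2 * (2 * max (Classical.choose (exists_norm_le R)) 0 + 7) ^ 2 := by
  rw [card_faces]
  set ρ : ℝ := Classical.choose (exists_norm_le R) with hρ
  have hρ0 : 0 ≤ max ρ 0 := le_max_right _ _
  have hn : ((boxN R δ : ℕ) : ℝ) ≤ max ρ 0 / δ + 3 := by
    have hdef : boxN R δ = ⌈ρ / δ⌉₊ + 2 := rfl
    rw [hdef]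
    push_cast
    have h1 : (⌈ρ / δ⌉₊ : ℝ) ≤ (⌈max ρ 0 / δ⌉₊ : ℝ) := by
      exact_mod_cast Nat.ceil_le_ceil (div_le_div_of_nonneg_right (le_max_left _ _) hδ.le)
    have h2 : (⌈max ρ 0 / δ⌉₊ : ℝ) < max ρ 0 / δ + 1 := Nat.ceil_lt_add_one (by positivity)
    linarith
  have hkey : (2 * (boxN R δ : ℝ) + 1) * δ ≤ 2 * max ρ 0 + 7 := by
    have h3 : (2 * (boxN R δ : ℝ) + 1) * δ ≤ (2 * (max ρ 0 / δ + 3) + 1) * δ :=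
      mul_le_mul_of_nonneg_right (by linarith) hδ.le
    have h4 : (2 * (max ρ 0 / δ + 3) + 1) * δ = 2 * max ρ 0 + 7 * δ := by
      field_simp
      ring
    rw [h4] at h3
    nlinarith
  have h0 : 0 ≤ (2 * (boxN R δ : ℝ) + 1) * δ := by positivity
  push_cast
  calc (2 : ℝ) * (2 * (boxN R δ : ℝ) + 1) ^ 2 * δ ^ 2 = 2 * ((2 * (boxN R δ : ℝ) + 1) * δ) ^ 2 := by
        ring
    _ ≤ 2 * (2 * max ρ 0 + 7) ^ 2 := by
        have h5 : ((2 * (boxN R δ : ℝ) + 1) * δ) ^ 2 ≤ (2 * max ρ 0 + 7) ^ 2 :=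
          pow_le_pow_left₀ h0 hkey 2
        linarith

/-! ### The budget is eventually uniformly small -/

/-- **Core estimate.**  Under `BulkArm ε` (`ε > 0`) and `LayerArm`, for every `e > 0` the budget
at exponent `1` is at most `e` for all `t ∈ [0, 1]`, eventually as `δ → 0⁺`. -/
theorem eventually_budget_le {ε : ℝ} (hε : 0 < ε) (hB : BulkArm ε) (hL : LayerArm)
    (R : ConformalRectangle) {C₀ : ℝ} (hC₀ : 0 < C₀) {e : ℝ} (he : 0 < e) :
    ∀ᶠ δ in 𝓝[>] (0 : ℝ), ∀ t ∈ Icc (0 : ℝ) 1,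
      ∑ k ∈ faces R δ, cutoff C₀ 1 δ (depth R δ k.1) * armWeight R t δ k ≤ e := by
  obtain ⟨r₀, hr₀, δ₁, hδ₁, hlayer⟩ := hL R (e / 2) (half_pos he)
  obtain ⟨C, hbulk⟩ := hB R r₀ hr₀
  set ρ : ℝ := Classical.choose (exists_norm_le R) with hρ
  set M : ℝ := 2 * (2 * max ρ 0 + 7) ^ 2 * (C₀ * max C 0 / r₀) with hM
  have h1 : ∀ᶠ δ in 𝓝[>] (0 : ℝ), δ ∈ Ioi (0 : ℝ) := eventually_mem_nhdsWithin
  have h2 : ∀ᶠ δ in 𝓝[>] (0 : ℝ), δ < δ₁ :=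
    (eventually_lt_nhds hδ₁).filter_mono nhdsWithin_le_nhds
  have h3 : ∀ᶠ δ in 𝓝[>] (0 : ℝ), δ < 1 :=
    (eventually_lt_nhds one_pos).filter_mono nhdsWithin_le_nhds
  have h4 : ∀ᶠ δ in 𝓝[>] (0 : ℝ), δ < r₀ / C₀ :=
    (eventually_lt_nhds (div_pos hr₀ hC₀)).filter_mono nhdsWithin_le_nhds
  have h5 : ∀ᶠ δ in 𝓝[>] (0 : ℝ), M * δ ^ ε < e / 2 := by
    have hc : Tendsto (fun δ : ℝ => M * δ ^ ε) (𝓝[>] 0) (𝓝 0) := by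
      have h := ((Real.continuousAt_rpow_const 0 ε (Or.inr hε.le)).tendsto).mono_left
        (nhdsWithin_le_nhds (s := Ioi (0 : ℝ)))
      rw [Real.zero_rpow hε.ne'] at h
      simpa using h.const_mul M
    exact hc.eventually (eventually_lt_nhds (half_pos he))
  filter_upwards [h1, h2, h3, h4, h5] with δ hδ hδδ₁ hδ1 hδr hδM
  rw [mem_Ioi] at hδ
  intro t ht
  have hr : C₀ * δ < r₀ := by
    have := (lt_div_iff₀ hC₀).1 hδr
    linarith [mul_comm δ C₀]
  rw [← Finset.sum_filter_add_sum_filter_not (faces R δ) (fun k => depth R δ k.1 < r₀)]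
  have hlay : ∑ k ∈ (faces R δ).filter (fun k => depth R δ k.1 < r₀),
      cutoff C₀ 1 δ (depth R δ k.1) * armWeight R t δ k ≤ e / 2 :=
    calc ∑ k ∈ (faces R δ).filter (fun k => depth R δ k.1 < r₀),
          cutoff C₀ 1 δ (depth R δ k.1) * armWeight R t δ k
        ≤ ∑ k ∈ (faces R δ).filter (fun k => depth R δ k.1 < r₀), armWeight R t δ k :=
          Finset.sum_le_sum fun k _ =>
            mul_le_of_le_one_left (armWeight_nonneg R t δ k) (cutoff_le_one hC₀ hδ zero_le_one _)
      _ ≤ e / 2 := hlayer δ hδ hδδ₁ t ht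
  have hblk : ∑ k ∈ (faces R δ).filter (fun k => ¬ depth R δ k.1 < r₀),
      cutoff C₀ 1 δ (depth R δ k.1) * armWeight R t δ k ≤ e / 2 := by
    set b : ℝ := C₀ * δ / r₀ * (max C 0 * δ ^ (1 + ε)) with hb
    have hb0 : 0 ≤ b := by positivity
    have hterm : ∀ k ∈ (faces R δ).filter (fun k => ¬ depth R δ k.1 < r₀),
        cutoff C₀ 1 δ (depth R δ k.1) * armWeight R t δ k ≤ b := by
      intro k hk
      rw [Finset.mem_filter, not_lt] at hk
      have haw : armWeight R t δ k ≤ max C 0 * δ ^ (1 + ε) :=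
        (hbulk δ hδ hδ1 t ht k hk.1 hk.2).trans
          (mul_le_mul_of_nonneg_right (le_max_left _ _) (Real.rpow_nonneg hδ.le _))
      exact mul_le_mul (cutoff_one_le_div hC₀ hδ hr hk.2) haw (armWeight_nonneg R t δ k)
        (by positivity)
    have hsplit : δ ^ (1 + ε) = δ * δ ^ ε := by rw [Real.rpow_add hδ, Real.rpow_one]
    calc ∑ k ∈ (faces R δ).filter (fun k => ¬ depth R δ k.1 < r₀),
          cutoff C₀ 1 δ (depth R δ k.1) * armWeight R t δ k
        ≤ ((faces R δ).filter (fun k => ¬ depth R δ k.1 < r₀)).card • b :=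
          Finset.sum_le_card_nsmul _ _ _ hterm
      _ = (((faces R δ).filter (fun k => ¬ depth R δ k.1 < r₀)).card : ℝ) * b := nsmul_eq_mul _ _
      _ ≤ ((faces R δ).card : ℝ) * b :=
          mul_le_mul_of_nonneg_right (by exact_mod_cast Finset.card_filter_le _ _) hb0
      _ = ((faces R δ).card : ℝ) * δ ^ 2 * (C₀ * max C 0 / r₀ * δ ^ ε) := by
          rw [hb, hsplit]; ring
      _ ≤ 2 * (2 * max ρ 0 + 7) ^ 2 * (C₀ * max C 0 / r₀ * δ ^ ε) :=
          mul_le_mul_of_nonneg_right (card_faces_mul_sq_le R hδ hδ1.le) (by positivity)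
      _ = M * δ ^ ε := by rw [hM]; ring
      _ ≤ e / 2 := hδM.le
  linarith

/-! ### The supremum over the leg parameter as rate function -/

/-- If a two-parameter quantity `S t δ` is nonnegative on `[0,1] × (0, ∞)` and, for every
`e > 0`, eventually (as `δ → 0⁺`) at most `e` uniformly in `t ∈ [0,1]`, then
`δ ↦ sSup (S · δ '' [0,1])` tends to `0` along `𝓝[>] 0`. -/
theorem tendsto_sSup_image_nhdsGT {S : ℝ → ℝ → ℝ}
    (h0 : ∀ δ : ℝ, 0 < δ → ∀ t ∈ Icc (0 : ℝ) 1, 0 ≤ S t δ)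
    (hsmall : ∀ e : ℝ, 0 < e → ∀ᶠ δ in 𝓝[>] (0 : ℝ), ∀ t ∈ Icc (0 : ℝ) 1, S t δ ≤ e) :
    Tendsto (fun δ => sSup ((fun t => S t δ) '' Icc (0 : ℝ) 1)) (𝓝[>] 0) (𝓝 0) := by
  rw [tendsto_order]
  constructor
  · intro a ha
    filter_upwards [eventually_mem_nhdsWithin (a := (0 : ℝ)) (s := Ioi (0 : ℝ))] with δ hδ
    rw [mem_Ioi] at hδ
    exact lt_of_lt_of_le ha (Real.sSup_nonneg (forall_mem_image.2 fun t ht => h0 δ hδ t ht))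
  · intro a ha
    filter_upwards [hsmall (a / 2) (half_pos ha)] with δ hδ
    refine lt_of_le_of_lt (csSup_le ((nonempty_Icc.2 zero_le_one).image _) ?_) (half_lt_self ha)
    exact forall_mem_image.2 fun t ht => hδ t ht

/-! ### W3: the arm budget at exponent `1` from its two halves -/

/-- **W3.**  `BulkArm ε` (`ε > 0`: four-arm weights `≤ C δ^{1+ε}` at depth `≥ r₀`) and `LayerArm`
(the faces at depth `< r₀` carry total weight `≤ η` for small mesh) give the a-priori arm estimate
`ArmBudget 1`, with rate function `η δ = sSup_t S(t, δ)` (the supremum over the leg parameter of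
the budget sum). -/
theorem armBudget_one_of_bulkArm_layerArm : ∀ ε : ℝ, 0 < ε →
    Summit.CriticalPhenomena.CardyFormulaZ2.Theorems.BitsLeg.BulkArm ε →
      Summit.CriticalPhenomena.CardyFormulaZ2.Theorems.BitsLeg.LayerArm →
        Summit.CriticalPhenomena.CardyFormulaZ2.Theorems.BitsLeg.ArmBudget 1 := by
  intro ε hε hB hL R C₀ hC₀
  refine ⟨fun δ => sSup ((fun t => ∑ k ∈ faces R δ,
      cutoff C₀ 1 δ (depth R δ k.1) * armWeight R t δ k) '' Icc (0 : ℝ) 1), ?_, ?_⟩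
  · exact tendsto_sSup_image_nhdsGT
      (S := fun t δ => ∑ k ∈ faces R δ, cutoff C₀ 1 δ (depth R δ k.1) * armWeight R t δ k)
      (fun δ hδ t _ => budget_nonneg R hC₀ hδ t)
      (fun e he => eventually_budget_le hε hB hL R hC₀ he)
  · intro δ hδ _ t ht
    exact le_csSup ⟨2 * (faces R δ).card, forall_mem_image.2 fun t' _ =>
      budget_le_card R hC₀ hδ zero_le_one t'⟩ (mem_image_of_mem _ ht)

end Summit.CriticalPhenomena.CardyFormulaZ2.Theorems.BitsLeg

end
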